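/-
COR-CM (cell pub-hodgecm2, stage 2 of the Hodge ladder) — count-neutral KERNEL COMBINATORICS «the quaternion presentation, abstractly: G ≃* Q_{4n}
and seat b09ʼs quaternion column transported» (seat prover-pub-hodgecm2-b23-g50-0, binder prover b23, gen 50; own census lane INDEX-TWO CYCLIC
2-GROUPS, claim HOME/INBOX.md l.23042).  Two bookkeeping definitions with bodies (the map `Q_{4n} → G` of a quaternion presentation and the
isomorphism it induces) + theorems; seat b09ʼs `Census/QuaternionColumnAllLevels.lean` and this seatʼs `Census/GroupIsoTransport.lean` are used
BY NAME; no `decide`, no certificate, no named fact, no `sorry`.  `Interfaces.lean` (C1), every E term, B01, `Transposition/*`, `PortJoin/*`,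
`D2Bridge/*` untouched.
HONEST FRAMING: `HC_CM` is NOT proved, here or anywhere in the tree; nothing here is a period, a count of record or a headline.
T5: n/a-class (hypothesis binders: `orderOf u = 2n`, `[G : ⟨u⟩] = 2`, `w ∉ ⟨u⟩`, `w² = uⁿ`, `w u w⁻¹ = u⁻¹` — inhabited by `QuaternionGroup n`
itself with `u = a 1`, `w = xa 0`; checker: self, 2026-08-25).
-/
import Summits.HodgeConjecture.CorCM.Census.QuaternionColumnAllLevels
import Summits.HodgeConjecture.CorCM.Census.GroupIsoTransport
import HarnessLib

/-!
# The quaternion presentation in an abstract group, and the quaternion column transported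

Let `u, w ∈ G` with `ord u = 2n`, `[G : ⟨u⟩] = 2`, `w ∉ ⟨u⟩`, `w² = uⁿ`, `w u w⁻¹ = u⁻¹` — the third branch of the trichotomy of
`Census/IndexTwoCyclicNormalForm.lean`.  Then `aⁱ ↦ uⁱ`, `x aⁱ ↦ w uⁱ` is a group isomorphism `QuaternionGroup n ≃* G` carrying seat b09ʼs
central involution `c n = aⁿ` to `uⁿ` (§1–§2, `quaternionEquiv`, `quaternionEquiv_c`), and by census invariance under group isomorphism
(`Census/GroupIsoTransport.lean`) seat b09ʼs QUATERNION COLUMN `μ(Q_{4n}, c) = φ₂(Q_{4n}, c)` (`n ≥ 2`,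
`Census/QuaternionColumnAllLevels.lean`) holds for `(G, uⁿ)`:

* §3 **`isLeast_card_gfaces_generate_fibreTwo_of_quaternion (u w) (hun : uⁿ = c) (hord) (hindex) (hw) (hww : w·w = c) (hwu) (h2 : 2 ≤ n)`**:
  `IsLeast {|S| : S ⊆ gfaceSet generating hodgeSpan mod pairs} (φ₂(G, c))` — structure-free, ready for the capstone
  `Census/IndexTwoCyclicTwoGroups.lean`.

## References
* [Pohlmann1968] H. Pohlmann, Algebraic cycles on abelian varieties of complex multiplication type, Ann. of Math. 88 (1968), Thm 1.
-/

namespace Summit.HodgeConjecture.CorCM.Census.IndexTwoCyclic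

open QuaternionGroup
open Summit.HodgeConjecture.CorCM.Prior.AllgGroup.RfwfAllgGroup
open Summit.HodgeConjecture.CorCM.Census.BlockParity
open Summit.HodgeConjecture.CorCM.Census.Coinvariant

noncomputable section

variable {G : Type*} [Group G] {n : ℕ}

/-! ## §1 Powers indexed by `ℤ/2n` -/

/-- `ℤ/2n`-indexed powers `u^{i}` of an element of order `2n` (exponent read through `ZMod.val`). [folklore] -/
theorem pow_val_add [NeZero n] {u : G} (hord : orderOf u = 2 * n) (i j : ZMod (2 * n)) :
    u ^ (i + j).val = u ^ i.val * u ^ j.val := by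
  have h := pow_mod_orderOf u (i.val + j.val)
  rw [hord] at h
  rw [ZMod.val_add, h, pow_add]

/-- `u^{(−i)} = (u^{i})⁻¹`. [folklore] -/
theorem pow_val_neg [NeZero n] {u : G} (hord : orderOf u = 2 * n) (i : ZMod (2 * n)) : u ^ (-i).val = (u ^ i.val)⁻¹ := by
  apply eq_inv_of_mul_eq_one_left
  rw [← pow_val_add hord, neg_add_cancel, ZMod.val_zero, pow_zero]

/-- `u^{(j − i)} = (u^{i})⁻¹ · u^{j}`. [folklore] -/
theorem pow_val_sub [NeZero n] {u : G} (hord : orderOf u = 2 * n) (i j : ZMod (2 * n)) : u ^ (j - i).val = (u ^ i.val)⁻¹ * u ^ j.val := by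
  rw [sub_eq_neg_add, pow_val_add hord, pow_val_neg hord]

/-- `u^{(k : ℤ/2n)} = uᵏ` for a natural number `k`. [folklore] -/
theorem pow_val_natCast {u : G} (hord : orderOf u = 2 * n) (k : ℕ) : u ^ ((k : ZMod (2 * n))).val = u ^ k := by
  rw [ZMod.val_natCast, ← hord, pow_mod_orderOf]

/-- Under `w u w⁻¹ = u⁻¹`: `w · u^{i} = u^{(−i)} · w`. [folklore] -/
theorem w_mul_pow_val [NeZero n] {u w : G} (hord : orderOf u = 2 * n) (hwu : w * u * w⁻¹ = u⁻¹) (i : ZMod (2 * n)) :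
    w * u ^ i.val = u ^ (-i).val * w := by
  have h : w * u ^ i.val * w⁻¹ = (u ^ i.val)⁻¹ := by
    rw [← MulAut.conj_apply, map_pow, MulAut.conj_apply, hwu, inv_pow]
  rw [pow_val_neg hord, ← h, inv_mul_cancel_right]

/-- Under `w u w⁻¹ = u⁻¹`: `u^{i} · w = w · u^{(−i)}`. [folklore] -/
theorem pow_val_mul_w [NeZero n] {u w : G} (hord : orderOf u = 2 * n) (hwu : w * u * w⁻¹ = u⁻¹) (i : ZMod (2 * n)) :
    u ^ i.val * w = w * u ^ (-i).val := by
  rw [w_mul_pow_val hord hwu, neg_neg]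

/-! ## §2 The isomorphism `QuaternionGroup n ≃* G` of a quaternion presentation -/

/-- **The map of a quaternion presentation**: `aⁱ ↦ uⁱ`, `x aⁱ ↦ w uⁱ`. [folklore] -/
def quaternionMap (u w : G) : QuaternionGroup n → G
  | a i => u ^ i.val
  | xa i => w * u ^ i.val

/-- The map of a quaternion presentation is multiplicative. [folklore] -/
theorem quaternionMap_mul [NeZero n] {u w : G} (hord : orderOf u = 2 * n) (hww : w * w = u ^ n) (hwu : w * u * w⁻¹ = u⁻¹)
    (x y : QuaternionGroup n) : quaternionMap u w (x * y) = quaternionMap u w x * quaternionMap u w y := by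
  have hn : u ^ n = u ^ ((n : ℕ) : ZMod (2 * n)).val := (pow_val_natCast hord n).symm
  cases x with
  | a i =>
    cases y with
    | a j => simp only [a_mul_a, quaternionMap, pow_val_add hord]
    | xa j =>
      simp only [a_mul_xa, quaternionMap]
      rw [← mul_assoc, pow_val_mul_w hord hwu, mul_assoc, ← pow_val_add hord, neg_add_eq_sub]
  | xa i =>
    cases y with
    | a j => simp only [xa_mul_a, quaternionMap, pow_val_add hord, mul_assoc]
    | xa j =>
      simp only [xa_mul_xa, quaternionMap]
      rw [mul_assoc, ← mul_assoc (u ^ i.val), pow_val_mul_w hord hwu, mul_assoc, ← mul_assoc w w, hww, hn, ← pow_val_add hord,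
        ← pow_val_add hord, neg_add_eq_sub, add_sub_assoc]

/-- The map of a quaternion presentation as a group homomorphism. [folklore] -/
def quaternionHom [NeZero n] {u w : G} (hord : orderOf u = 2 * n) (hww : w * w = u ^ n) (hwu : w * u * w⁻¹ = u⁻¹) : QuaternionGroup n →* G :=
  MonoidHom.mk' (quaternionMap u w) (quaternionMap_mul hord hww hwu)

/-- The map of a quaternion presentation is onto when `[G : ⟨u⟩] = 2` and `w ∉ ⟨u⟩`. [folklore] -/
theorem quaternionMap_surjective [Finite G] {u w : G} (hord : orderOf u = 2 * n) (hindex : (Subgroup.zpowers u).index = 2)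
    (hw : w ∉ Subgroup.zpowers u) : Function.Surjective (quaternionMap (n := n) u w) := by
  have hpow : ∀ z : G, z ∈ Subgroup.zpowers u → ∃ i : ZMod (2 * n), u ^ i.val = z := by
    intro z hz
    have hz' : z ∈ Submonoid.powers u := ((isOfFinOrder_of_finite u).mem_powers_iff_mem_zpowers).mpr hz
    obtain ⟨k, rfl⟩ := (Submonoid.mem_powers_iff _ _).mp hz'
    exact ⟨k, pow_val_natCast hord k⟩
  intro x
  by_cases hx : x ∈ Subgroup.zpowers u
  · obtain ⟨i, hi⟩ := hpow x hx
    exact ⟨a i, hi⟩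
  · have hwx : w⁻¹ * x ∈ Subgroup.zpowers u := by
      rw [Subgroup.mul_mem_iff_of_index_two hindex, Subgroup.inv_mem_iff]
      exact ⟨fun h => absurd h hw, fun h => absurd h hx⟩
    obtain ⟨i, hi⟩ := hpow _ hwx
    exact ⟨xa i, by change w * u ^ i.val = x; rw [hi, mul_inv_cancel_left]⟩

/-- `|G| = 4n` when `ord u = 2n` and `[G : ⟨u⟩] = 2`. [folklore] -/
theorem card_eq_four_mul [Fintype G] {u : G} (hord : orderOf u = 2 * n) (hindex : (Subgroup.zpowers u).index = 2) : Fintype.card G = 4 * n := by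
  have h := (Subgroup.zpowers u).card_mul_index
  rw [hindex, Nat.card_zpowers, hord, Nat.card_eq_fintype_card] at h
  omega

/-- **THE ISOMORPHISM OF A QUATERNION PRESENTATION** `QuaternionGroup n ≃* G`: `ord u = 2n`, `[G : ⟨u⟩] = 2`, `w ∉ ⟨u⟩`, `w² = uⁿ`,
`w u w⁻¹ = u⁻¹`. [folklore] -/
def quaternionEquiv [Fintype G] [NeZero n] {u w : G} (hord : orderOf u = 2 * n) (hindex : (Subgroup.zpowers u).index = 2) (hw : w ∉ Subgroup.zpowers u)
    (hww : w * w = u ^ n) (hwu : w * u * w⁻¹ = u⁻¹) : QuaternionGroup n ≃* G :=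
  MulEquiv.ofBijective (quaternionHom hord hww hwu)
    ((Fintype.bijective_iff_surjective_and_card _).mpr
      ⟨quaternionMap_surjective hord hindex hw, by rw [QuaternionGroup.card, card_eq_four_mul hord hindex]⟩)

/-- The isomorphism on generators: `a i ↦ u^{i}`. [folklore] -/
theorem quaternionEquiv_a [Fintype G] [NeZero n] {u w : G} (hord : orderOf u = 2 * n) (hindex : (Subgroup.zpowers u).index = 2)
    (hw : w ∉ Subgroup.zpowers u) (hww : w * w = u ^ n) (hwu : w * u * w⁻¹ = u⁻¹) (i : ZMod (2 * n)) :
    quaternionEquiv hord hindex hw hww hwu (a i) = u ^ i.val := rfl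

/-- The isomorphism on the coset: `x aⁱ ↦ w u^{i}`. [folklore] -/
theorem quaternionEquiv_xa [Fintype G] [NeZero n] {u w : G} (hord : orderOf u = 2 * n) (hindex : (Subgroup.zpowers u).index = 2)
    (hw : w ∉ Subgroup.zpowers u) (hww : w * w = u ^ n) (hwu : w * u * w⁻¹ = u⁻¹) (i : ZMod (2 * n)) :
    quaternionEquiv hord hindex hw hww hwu (xa i) = w * u ^ i.val := rfl

/-- **The isomorphism carries seat b09ʼs central involution `c n = aⁿ` to `uⁿ`.** [folklore] -/
theorem quaternionEquiv_c [Fintype G] [NeZero n] {u w : G} (hord : orderOf u = 2 * n) (hindex : (Subgroup.zpowers u).index = 2)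
    (hw : w ∉ Subgroup.zpowers u) (hww : w * w = u ^ n) (hwu : w * u * w⁻¹ = u⁻¹) :
    quaternionEquiv hord hindex hw hww hwu (QuaternionColumn.c n) = u ^ n := by
  rw [QuaternionColumn.c, quaternionEquiv_a, pow_val_natCast hord]

/-- The model itself carries the presentation: `u = a 1`, `w = xa 0` in `QuaternionGroup n` (so the hypotheses of §3 are inhabited). [folklore] -/
theorem quaternionGroup_presentation [NeZero n] :
    orderOf (a 1 : QuaternionGroup n) = 2 * n ∧ (xa (0 : ZMod (2 * n))) * xa 0 = (a 1) ^ n ∧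
      xa (0 : ZMod (2 * n)) * a 1 * (xa 0)⁻¹ = (a 1)⁻¹ := by
  refine ⟨orderOf_a_one, ?_, ?_⟩
  · rw [xa_mul_xa, a_one_pow, sub_zero, add_zero]
  · have hinv : (a 1 : QuaternionGroup n)⁻¹ = a (-1) := inv_eq_of_mul_eq_one_right (by rw [a_mul_a, add_neg_cancel, a_zero])
    rw [mul_inv_eq_iff_eq_mul, hinv, xa_mul_a, a_mul_xa, zero_add, zero_sub, neg_neg]

/-! ## §3 The quaternion column, transported -/

/-- **`μ(G, c) = φ₂(G, c)` FOR EVERY ABSTRACT QUATERNION PRESENTATION** (`n ≥ 2`): `u` of order `2n` with `uⁿ = c`, `[G : ⟨u⟩] = 2`,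
`w ∉ ⟨u⟩` with `w² = c` and `w u w⁻¹ = u⁻¹`.  Seat b09ʼs quaternion column `μ(Q_{4n}, aⁿ) = φ₂` (`Census/QuaternionColumnAllLevels.lean`)
transported along `quaternionEquiv` by `Census/GroupIsoTransport.lean`. [folklore] -/
theorem isLeast_card_gfaces_generate_fibreTwo_of_quaternion [Fintype G] [DecidableEq G] {c : G} (hc2 : c * c = 1) (u w : G) (hun : u ^ n = c)
    (hord : orderOf u = 2 * n) (hindex : (Subgroup.zpowers u).index = 2) (hw : w ∉ Subgroup.zpowers u) (hww : w * w = c)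
    (hwu : w * u * w⁻¹ = u⁻¹) (h2 : 2 ≤ n) :
    IsLeast {m : ℕ | ∃ S : Finset (CMF G c →₀ ℤ), ↑S ⊆ gfaceSet G c hc2 ∧ S.card = m ∧
      hodgeSpan c hc2 ≤ Submodule.span ℤ (pairSet c) ⊔ Submodule.span ℤ (translates c S)} (fibreTwo c hc2) := by
  haveI : NeZero n := ⟨by omega⟩
  subst hun
  have hc := quaternionEquiv_c hord hindex hw hww hwu
  rw [← GroupIso.fibreTwo_eq (quaternionEquiv hord hindex hw hww hwu) hc QuaternionColumn.c_mul_c hc2]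
  exact GroupIso.isLeast_map (quaternionEquiv hord hindex hw hww hwu) hc QuaternionColumn.c_mul_c hc2
    (QuaternionColumn.isLeast_card_gfaces_generate_quaternion_all h2)

/-- Block currency: **`μ(G, uⁿ) = β(G, uⁿ) − [n odd]`** for every abstract quaternion presentation, `n ≥ 2`. [folklore] -/
theorem isLeast_card_gfaces_generate_of_quaternion [Fintype G] [DecidableEq G] {c : G} (hc2 : c * c = 1) (u w : G) (hun : u ^ n = c)
    (hord : orderOf u = 2 * n) (hindex : (Subgroup.zpowers u).index = 2) (hw : w ∉ Subgroup.zpowers u) (hww : w * w = c)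
    (hwu : w * u * w⁻¹ = u⁻¹) (h2 : 2 ≤ n) :
    IsLeast {m : ℕ | ∃ S : Finset (CMF G c →₀ ℤ), ↑S ⊆ gfaceSet G c hc2 ∧ S.card = m ∧
      hodgeSpan c hc2 ≤ Submodule.span ℤ (pairSet c) ⊔ Submodule.span ℤ (translates c S)}
      (Fintype.card (Block c) - (if Even n then 0 else 1)) := by
  haveI : NeZero n := ⟨by omega⟩
  subst hun
  have hc := quaternionEquiv_c hord hindex hw hww hwu
  rw [← GroupIso.card_block_eq (quaternionEquiv hord hindex hw hww hwu) hc]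
  exact GroupIso.isLeast_map (quaternionEquiv hord hindex hw hww hwu) hc QuaternionColumn.c_mul_c hc2
    (QuaternionColumn.isLeast_card_gfaces_generate_quaternion_all_card_block h2)

end

end Summit.HodgeConjecture.CorCM.Census.IndexTwoCyclic
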